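import Summits.ValiantsHypothesis.ValiantsHypothesis.Theorems.FermionicJetQuadraticDcCdetHessian

/-!
# Route `FermionicJet`, crux `QuadraticDcCdet` (stmt-ValiantsHypothesis-5343) — helper 3b:
# the Hessian of `cdet` at an all-ones matrix with one modified DIAGONAL entry

Companion of helper 3 (`hessianMatrix_cdetPoly_onePlus_apply`, off-diagonal modified entry), used
for the smallest case `n = 3` where the off-diagonal family degenerates: for the point `y_s` with
`y_s(p, p) = 1 + s` and all other entries `1` (`|ι| = m + 3`),
* `eval_cdetPoly_diagPlus` : `cdet(y_s) = K_{m+3} + s (K_{m+2} + Z_{m+2})`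
  (`= (-1)^{m+1} m! (m + 1 - s)` for `m ≥ 0`; zero at `s = m + 1`, e.g. `y(p,p) = 2` for `n = 3`);
* `hessianMatrix_cdetPoly_diagPlus_apply` : the entry `((c,d),(a,b))` of the Hessian at `y_s` is
  `0` if `b = d` or `a = c`, else `W(a,b,c,d; m+1) + s [p ∉ {a,b,c,d}] (W + V)(a,b,c,d; m)` where
  `W = ε_K K + ε_Z Z` is the signed-cycle two-value sum and `V = ε_K Z` the sign-only one (a
  prescribed fixed point `π p = p` raises the cycle count by one: `sum_three_apply_eq_self`).
HONEST FRAMING: bookkeeping for the `n = 3` instance of a dormant route's crux; nothing here bears on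
`VP ≠ VNP`, which is NOT proved.
-/

noncomputable section

open MvPolynomial Equiv Equiv.Perm Finset

-- layout Summits/ValiantsHypothesis/ValiantsHypothesis forces the duplicated namespace component
set_option linter.dupNamespace false

namespace Summit.ValiantsHypothesis.ValiantsHypothesis.Theorems.FermionicJet.CdetHessian

open Literature.Computability.AlgebraicComplexity
open Summit.ValiantsHypothesis.ValiantsHypothesis.Theorems.FermionicJet.NumCyclesSums

universe u v

variable {k : Type u} [CommRing k] {ι : Type v} [Fintype ι] [DecidableEq ι]

/-- **`cdet` at the diagonal point**: `cdet(y_s) = K_{m+3} + s (K_{m+2} + Z_{m+2})`, i.e.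
`(-1)^{m+1} (m+1)! + s ((-1)^m m! + [m = 0]·0 + [m+2 ≤ 1]…)`; written with the case split of the
closed forms. -/
theorem eval_cdetPoly_diagPlus {m : ℕ} (hι : Fintype.card ι = m + 3) (p : ι) (s : k) :
    eval (fun ij : ι × ι => if ij = (p, p) then 1 + s else (1 : k)) (cdetPoly ι k) =
      (-1) ^ (m + 1) * ((m + 1).factorial : k) + s * ((-1) ^ m * (m.factorial : k)) := by
  have hsum : eval (fun ij : ι × ι => if ij = (p, p) then 1 + s else (1 : k)) (cdetPoly ι k) =
      ∑ π : Perm ι, (((Perm.sign π : ℤ) : k) * (π.numCycles : k) +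
        s * (if π p = p then ((Perm.sign π : ℤ) : k) * (π.numCycles : k) else 0)) := by
    rw [cdetPoly, map_sum]
    refine Finset.sum_congr rfl fun π _ => ?_
    simp only [map_mul, eval_C, map_prod, eval_X, Int.cast_mul, Int.cast_natCast]
    rw [prod_onePlus p p s]
    simp only [Finset.mem_univ, true_and]
    split_ifs <;> ring
  rw [hsum, Finset.sum_add_distrib, ← Finset.mul_sum,
    sum_sign_mul_numCycles_eq (m + 3) ι hι, sum_sign_mul_numCycles_apply_eq p p, if_pos rfl,
    if_pos rfl, one_mul, one_mul,
    sum_sign_mul_numCycles_eq (m + 2) {y // y ≠ p} (by rw [card_subtype_ne, hι]; omega),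
    sum_sign_eq (m + 2) {y // y ≠ p} (by rw [card_subtype_ne, hι]; omega),
    if_neg (by omega), if_neg (by omega), if_neg (by omega), show m + 3 - 2 = m + 1 from rfl,
    show m + 2 - 2 = m from rfl, pow_succ, pow_succ]
  ring

/-- **The diagonal point `y(p,p) = m + 2` lies on the hypersurface** (`s = m + 1`). -/
theorem eval_cdetPoly_diagPlus_eq_zero {m : ℕ} (hι : Fintype.card ι = m + 3) (p : ι) :
    eval (fun ij : ι × ι => if ij = (p, p) then 1 + ((m : k) + 1) else (1 : k)) (cdetPoly ι k) = 0 := by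
  rw [eval_cdetPoly_diagPlus hι p, Nat.factorial_succ, pow_succ]
  push_cast
  ring

/-- **The Hessian of `cdet` at the diagonal point, closed form** (`|ι| = m + 3`): the entry
`((c,d),(a,b))` is `0` if `b = d` or `a = c`; otherwise `W(a,b,c,d; m+1)` plus
`s · [p ∉ {b, d}] [p ∉ {a, c}] · (W + V)(a,b,c,d; m)`, `W = ε_K K + ε_Z Z`, `V = ε_K Z`. -/
theorem hessianMatrix_cdetPoly_diagPlus_apply {m : ℕ} (hι : Fintype.card ι = m + 3) (p : ι)
    (s : k) (a b c d : ι) :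
    hessianMatrix (cdetPoly ι k) (fun ij : ι × ι => if ij = (p, p) then 1 + s else (1 : k))
        (c, d) (a, b) =
      (if b = d then 0 else if a = c then 0 else
        (if (a = b ∧ c = d) ∨ ¬((a = b ∨ c = d) ∨ (a = d ∧ c = b)) then (1 : k) else -1) *
            (if m + 1 ≤ 1 then ((m + 1 : ℕ) : k) else (-1) ^ (m + 1) * ((m + 1 - 2).factorial : k)) +
          (if a = b ∧ c = d then (2 : k) else if (a = b ∨ c = d) ∨ (a = d ∧ c = b) then -1
            else 0) * (if m + 1 ≤ 1 then (1 : k) else 0)) +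
      s * (if b = d ∨ p = b ∨ p = d then 0 else if a = p ∨ c = p then 0 else
        ((if a = c then 0 else
          (if (a = b ∧ c = d) ∨ ¬((a = b ∨ c = d) ∨ (a = d ∧ c = b)) then (1 : k) else -1) *
              (if m ≤ 1 then (m : k) else (-1) ^ m * ((m - 2).factorial : k)) +
            (if a = b ∧ c = d then (2 : k) else if (a = b ∨ c = d) ∨ (a = d ∧ c = b) then -1
              else 0) * (if m ≤ 1 then (1 : k) else 0)) +
         (if a = c then 0 else
          (if (a = b ∧ c = d) ∨ ¬((a = b ∨ c = d) ∨ (a = d ∧ c = b)) then (1 : k) else -1) *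
            (if m ≤ 1 then (1 : k) else 0)))) := by
  rw [hessianMatrix_cdetPoly_onePlus_eq_sum]
  congr 1
  · by_cases hbd : b = d
    · rw [if_pos hbd, if_pos hbd]
    · rw [if_neg hbd, if_neg hbd, sum_sign_mul_numCycles_apply_eq_two (m := m + 1) (by rw [hι]) hbd]
  · congr 1
    by_cases h0 : b = d ∨ p = b ∨ p = d
    · rw [if_pos h0, if_pos h0]
    · rw [if_neg h0, if_neg h0]
      have hbd : b ≠ d := fun h => h0 (Or.inl h)
      have hbp : b ≠ p := fun h => h0 (Or.inr (Or.inl h.symm))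
      have hdp : d ≠ p := fun h => h0 (Or.inr (Or.inr h.symm))
      rw [sum_three_apply_eq_self hbp hdp (fun (sg : ℤ) (cy : ℕ) => (sg : k) * (cy : k))]
      by_cases hp : a = p ∨ c = p
      · rw [if_pos hp, if_pos hp]
      rw [if_neg hp, if_neg hp]
      have hap : a ≠ p := fun h => hp (Or.inl h)
      have hcp : c ≠ p := fun h => hp (Or.inr h)
      have hcond : ∀ τ : Perm {y // y ≠ p},
          (((τ ⟨b, hbp⟩ : {y // y ≠ p}) : ι) = a ∧ ((τ ⟨d, hdp⟩ : {y // y ≠ p}) : ι) = c) =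
          (τ ⟨b, hbp⟩ = ⟨a, hap⟩ ∧ τ ⟨d, hdp⟩ = ⟨c, hcp⟩) := by
        intro τ
        rw [Subtype.ext_iff, Subtype.ext_iff]
      simp_rw [hcond]
      have hsplit : (∑ τ : Perm {y // y ≠ p}, if τ ⟨b, hbp⟩ = ⟨a, hap⟩ ∧ τ ⟨d, hdp⟩ = ⟨c, hcp⟩ then
            ((Perm.sign τ : ℤ) : k) * ((τ.numCycles + 1 : ℕ) : k) else 0) =
          (∑ τ : Perm {y // y ≠ p}, if τ ⟨b, hbp⟩ = ⟨a, hap⟩ ∧ τ ⟨d, hdp⟩ = ⟨c, hcp⟩ then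
            ((Perm.sign τ : ℤ) : k) * (τ.numCycles : k) else 0) +
          ∑ τ : Perm {y // y ≠ p}, if τ ⟨b, hbp⟩ = ⟨a, hap⟩ ∧ τ ⟨d, hdp⟩ = ⟨c, hcp⟩ then
            ((Perm.sign τ : ℤ) : k) else 0 := by
        rw [← Finset.sum_add_distrib]
        refine Finset.sum_congr rfl fun τ _ => ?_
        by_cases h : τ ⟨b, hbp⟩ = ⟨a, hap⟩ ∧ τ ⟨d, hdp⟩ = ⟨c, hcp⟩
        · rw [if_pos h, if_pos h, if_pos h]; push_cast; ring
        · rw [if_neg h, if_neg h, if_neg h, add_zero]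
      have hcard : Fintype.card {y // y ≠ p} = m + 2 := by rw [card_subtype_ne, hι]; omega
      rw [hsplit, sum_sign_mul_numCycles_apply_eq_two (m := m) hcard
          (fun h : (⟨b, hbp⟩ : {y // y ≠ p}) = ⟨d, hdp⟩ => hbd (Subtype.ext_iff.mp h)),
        sum_sign_apply_eq_two (m := m) hcard
          (fun h : (⟨b, hbp⟩ : {y // y ≠ p}) = ⟨d, hdp⟩ => hbd (Subtype.ext_iff.mp h))]
      simp only [Subtype.mk.injEq]

end Summit.ValiantsHypothesis.ValiantsHypothesis.Theorems.FermionicJet.CdetHessian
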